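import Summits.QuantumFields.YangMills.Theorems.FluctuationComparisonRegPrIntLS2BetaOneLevelStep
import HarnessLib

/-!
# S2β · letter (D♮) REL-TEL, the (C)-half — THE MEMBER-LOGARITHM PACKAGE OF ONE FIELD (✓`…S2BetaOneLevelStep`'s steps (A)–(B) isolated as a reusable theorem, so that the
# RELATIVE (C)-step `…S2BetaRelativeOneLevelStep` can run them on BOTH fields): member and context sizes, `Ū(∂Q) = e^{ā₁}e^{ā₂}e^{ā₃}e^{ā₄}·H₀` in matrices, `‖log Ū(∂Q)‖ ≤ 50τ`

Cell `ym3-torus` (rung R3 = continuum `SU(2)` Yang–Mills on the three-torus — NOT d = 4, NOT infinite volume, NOT a mass gap, NOT Clay).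
Width seat «width 10» `ym3-torus-px10` (gen 23), FREE px helper on crux `stmt-QuantumFields-20520`, count-neutral, DEFINITION-FREE; own-risk brick of the px10 lane
«(C)-half of letter (D♮)» (UV3-NODE §82).  Nothing new mathematically: ✓p817736's setup (✓G9 loop form, lit `dist1_loopHol_le`, `coe_avg_eq_exp_mean`, lit Prop. 1 crude
plaquette bound, (26)–(27)) stated ONCE for an arbitrary field `V` with `PlaqSmall θ V`.

HONEST SCOPE.  Bookkeeping; nothing of Bałaban's asserted; the relative (C)-step, (D-ax), (F-ax), GAP♯∘ (`stub_uniformFibreGapOrbit`), S2β, crux 20520 and `YM3TorusSU2` are NOT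
proved; no registered stub is closed; the Yang–Mills mass gap is NOT proved.  Sorry-free, axioms standard.
References: T. Bałaban, CMP **109** (1987) 249–301 [Balaban1987RG1] ((0.4)–(0.8) p.253); CMP **98** (1985) 17–51 [Balaban1985Averaging] ((19), (21) p.21, (26)–(27) p.22).
-/

set_option autoImplicit false

noncomputable section

namespace Summit.QuantumFields.YangMills.Theorems.FluctuationComparisonRegPrIntLS2BetaFieldPackage

open NormedSpace Finset
open scoped BigOperators Matrix.Norms.L2Operator
open Literature.MathematicalPhysics.QuantumFieldTheory.Balaban1983to89
open Literature.MathematicalPhysics.QuantumFieldTheory.Balaban1983to89.T4Continuum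
open Literature.MathematicalPhysics.QuantumFieldTheory.Balaban1983to89.AveragingRT
open Literature.MathematicalPhysics.QuantumFieldTheory.Balaban1983to89.BlockAveraging
open Literature.MathematicalPhysics.QuantumFieldTheory.Balaban1983to89.MatrixLog (mlog exp_mlog norm_mlog_le_two_mul)
open Literature.MathematicalPhysics.QuantumFieldTheory.Balaban1983to89.ExpMeanLog (expMeanLogSU deltaSU)
open Literature.MathematicalPhysics.QuantumFieldTheory.Balaban1983to89.LatticeWordStokes (dist1_loopHol_le small_of_plaqSmall)
open B10Eq47AxialChi (shiftN rect plaqSmall_axialAvg)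
open Summit.QuantumFields.YangMills.Theorems.FluctuationComparisonRegPrIntLS2BetaOneLevelStepLetters (coe_avg_eq_exp_mean norm_mean_le_mean memberWord_eq_conj_rect sq_L_le_quarter)

variable {n : Type*} [Fintype n] [DecidableEq n] [Nonempty n]
variable {P : Params} {j : ℕ}

/-! ## §1 One field: the member-logarithm package of the (C)-STEP (✓`…OneLevelStep`'s (A)–(B), isolated for reuse on both fields) -/

set_option maxHeartbeats 400000 in
/-- **THE MEMBER-LOGARITHM PACKAGE OF ONE FIELD** (standing range, `PlaqSmall θ V`, `((d+2)L)²θ ≤ 1∕50`, `((d+2)L)²θ∕4 < δ_N`; `τ := ((d+2)L)²θ∕4`; the four bonds `c₁..c₄`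
of the coarse plaquette `Q`, the coupled member families `W₁ = ℓ₁`, `W₂ = A₁ℓ₂A₁⁻¹`, `W₃ = P₃ℓ₃⁻¹P₃⁻¹`, `W₄ = H₀ℓ₄⁻¹H₀⁻¹` of ✓G9's loop form): (i) every member has `dist1 ≤ τ`
and logarithm `‖log W_m i‖ ≤ 2τ`; (ii) the context `H₀ = A₁A₂A₃⁻¹A₄⁻¹` has `‖H₀ − 1‖ ≤ e^{2τ} − 1`; (iii) `Ū(∂Q) = e^{ā₁}e^{ā₂}e^{ā₃}e^{ā₄}·H₀` in matrices; (iv)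
`‖log Ū(∂Q)‖ ≤ 50τ` and `dist1 Ū(∂Q) ≤ 25τ`. [cite: Balaban1987RG1, (0.4) p.253] -/
theorem field_package (hj : j + 1 ≤ P.m + P.K) (V : GaugeField P j (Matrix.specialUnitaryGroup n ℂ)) {θ : ℝ} (hθ0 : 0 ≤ θ)
    (hθ : (((P.d + 2) * P.L : ℕ) : ℝ) ^ 2 * θ ≤ 1 / 50) (hδ : (((P.d + 2) * P.L : ℕ) : ℝ) ^ 2 / 4 * θ < deltaSU n)
    (hV : PlaqSmall θ V) (Q : Plaq P (j + 1)) :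
    (∀ i, dist1 (loopHol V ⟨Q.src, Q.μ⟩ i) ≤ (((P.d + 2) * P.L : ℕ) : ℝ) ^ 2 / 4 * θ ∧
      dist1 (axialAvg V ⟨Q.src, Q.μ⟩ * loopHol V ⟨Q.src.shift Q.μ, Q.ν⟩ i * (axialAvg V ⟨Q.src, Q.μ⟩)⁻¹) ≤ (((P.d + 2) * P.L : ℕ) : ℝ) ^ 2 / 4 * θ ∧
      dist1 ((axialAvg V ⟨Q.src, Q.μ⟩ * axialAvg V ⟨Q.src.shift Q.μ, Q.ν⟩ * (axialAvg V ⟨Q.src.shift Q.ν, Q.μ⟩)⁻¹) * (loopHol V ⟨Q.src.shift Q.ν, Q.μ⟩ i)⁻¹ *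
        (axialAvg V ⟨Q.src, Q.μ⟩ * axialAvg V ⟨Q.src.shift Q.μ, Q.ν⟩ * (axialAvg V ⟨Q.src.shift Q.ν, Q.μ⟩)⁻¹)⁻¹) ≤ (((P.d + 2) * P.L : ℕ) : ℝ) ^ 2 / 4 * θ ∧
      dist1 ((axialAvg V ⟨Q.src, Q.μ⟩ * axialAvg V ⟨Q.src.shift Q.μ, Q.ν⟩ * (axialAvg V ⟨Q.src.shift Q.ν, Q.μ⟩)⁻¹ * (axialAvg V ⟨Q.src, Q.ν⟩)⁻¹) *
        (loopHol V ⟨Q.src, Q.ν⟩ i)⁻¹ * (axialAvg V ⟨Q.src, Q.μ⟩ * axialAvg V ⟨Q.src.shift Q.μ, Q.ν⟩ * (axialAvg V ⟨Q.src.shift Q.ν, Q.μ⟩)⁻¹ *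
        (axialAvg V ⟨Q.src, Q.ν⟩)⁻¹)⁻¹) ≤ (((P.d + 2) * P.L : ℕ) : ℝ) ^ 2 / 4 * θ) ∧
    ‖((axialAvg V ⟨Q.src, Q.μ⟩ * axialAvg V ⟨Q.src.shift Q.μ, Q.ν⟩ * (axialAvg V ⟨Q.src.shift Q.ν, Q.μ⟩)⁻¹ * (axialAvg V ⟨Q.src, Q.ν⟩)⁻¹ :
        Matrix.specialUnitaryGroup n ℂ) : Matrix n n ℂ) - 1‖ ≤ Real.exp (2 * ((((P.d + 2) * P.L : ℕ) : ℝ) ^ 2 / 4 * θ)) - 1 ∧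
    ((GaugeField.plaqHol (avgFun (expMeanLogSU (n := n)) V) Q : Matrix.specialUnitaryGroup n ℂ) : Matrix n n ℂ) =
      exp (((Fintype.card (Idx P) : ℝ))⁻¹ • ∑ i, mlog ((loopHol V ⟨Q.src, Q.μ⟩ i : Matrix.specialUnitaryGroup n ℂ) : Matrix n n ℂ)) *
      exp (((Fintype.card (Idx P) : ℝ))⁻¹ • ∑ i, mlog ((axialAvg V ⟨Q.src, Q.μ⟩ * loopHol V ⟨Q.src.shift Q.μ, Q.ν⟩ i * (axialAvg V ⟨Q.src, Q.μ⟩)⁻¹ :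
        Matrix.specialUnitaryGroup n ℂ) : Matrix n n ℂ)) *
      exp (((Fintype.card (Idx P) : ℝ))⁻¹ • ∑ i, mlog (((axialAvg V ⟨Q.src, Q.μ⟩ * axialAvg V ⟨Q.src.shift Q.μ, Q.ν⟩ * (axialAvg V ⟨Q.src.shift Q.ν, Q.μ⟩)⁻¹) *
        (loopHol V ⟨Q.src.shift Q.ν, Q.μ⟩ i)⁻¹ * (axialAvg V ⟨Q.src, Q.μ⟩ * axialAvg V ⟨Q.src.shift Q.μ, Q.ν⟩ * (axialAvg V ⟨Q.src.shift Q.ν, Q.μ⟩)⁻¹)⁻¹ :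
        Matrix.specialUnitaryGroup n ℂ) : Matrix n n ℂ)) *
      exp (((Fintype.card (Idx P) : ℝ))⁻¹ • ∑ i, mlog (((axialAvg V ⟨Q.src, Q.μ⟩ * axialAvg V ⟨Q.src.shift Q.μ, Q.ν⟩ * (axialAvg V ⟨Q.src.shift Q.ν, Q.μ⟩)⁻¹ *
        (axialAvg V ⟨Q.src, Q.ν⟩)⁻¹) * (loopHol V ⟨Q.src, Q.ν⟩ i)⁻¹ * (axialAvg V ⟨Q.src, Q.μ⟩ * axialAvg V ⟨Q.src.shift Q.μ, Q.ν⟩ *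
        (axialAvg V ⟨Q.src.shift Q.ν, Q.μ⟩)⁻¹ * (axialAvg V ⟨Q.src, Q.ν⟩)⁻¹)⁻¹ : Matrix.specialUnitaryGroup n ℂ) : Matrix n n ℂ)) *
      ((axialAvg V ⟨Q.src, Q.μ⟩ * axialAvg V ⟨Q.src.shift Q.μ, Q.ν⟩ * (axialAvg V ⟨Q.src.shift Q.ν, Q.μ⟩)⁻¹ * (axialAvg V ⟨Q.src, Q.ν⟩)⁻¹ :
        Matrix.specialUnitaryGroup n ℂ) : Matrix n n ℂ) ∧
    (‖mlog ((GaugeField.plaqHol (avgFun (expMeanLogSU (n := n)) V) Q : Matrix.specialUnitaryGroup n ℂ) : Matrix n n ℂ)‖ ≤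
        50 * ((((P.d + 2) * P.L : ℕ) : ℝ) ^ 2 / 4 * θ) ∧
      dist1 (GaugeField.plaqHol (avgFun (expMeanLogSU (n := n)) V) Q) ≤ 25 * ((((P.d + 2) * P.L : ℕ) : ℝ) ^ 2 / 4 * θ)) := by
  -- thresholds
  set cc : ℝ := (((P.d + 2) * P.L : ℕ) : ℝ) ^ 2 / 4 with hcc
  set τ : ℝ := cc * θ with hτdef
  have hcc0 : 0 ≤ cc := by positivity
  have hτ0 : 0 ≤ τ := mul_nonneg hcc0 hθ0
  have hτs : τ ≤ 1 / 200 := by rw [hτdef, hcc]; linarith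
  have hL2 : (P.L : ℝ) ^ 2 * θ ≤ τ := by rw [hτdef]; exact mul_le_mul_of_nonneg_right (sq_L_le_quarter P) hθ0
  set ℰ : LoopAverage (Matrix.specialUnitaryGroup n ℂ) := expMeanLogSU (n := n) with hℰ
  set c₁ : PBond P (j + 1) := ⟨Q.src, Q.μ⟩ with hc₁
  set c₂ : PBond P (j + 1) := ⟨Q.src.shift Q.μ, Q.ν⟩ with hc₂
  set c₃ : PBond P (j + 1) := ⟨Q.src.shift Q.ν, Q.μ⟩ with hc₃
  set c₄ : PBond P (j + 1) := ⟨Q.src, Q.ν⟩ with hc₄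
  set A₁ := axialAvg V c₁ with hA₁
  set A₂ := axialAvg V c₂ with hA₂
  set A₃ := axialAvg V c₃ with hA₃
  set A₄ := axialAvg V c₄ with hA₄
  set P₃ := A₁ * A₂ * A₃⁻¹ with hP₃
  set H₀ := A₁ * A₂ * A₃⁻¹ * A₄⁻¹ with hH₀
  set W₁ : Idx P → Matrix.specialUnitaryGroup n ℂ := fun i => loopHol V c₁ i with hW₁
  set W₂ : Idx P → Matrix.specialUnitaryGroup n ℂ := fun i => A₁ * loopHol V c₂ i * A₁⁻¹ with hW₂
  set W₃ : Idx P → Matrix.specialUnitaryGroup n ℂ := fun i => P₃ * (loopHol V c₃ i)⁻¹ * P₃⁻¹ with hW₃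
  set W₄ : Idx P → Matrix.specialUnitaryGroup n ℂ := fun i => H₀ * (loopHol V c₄ i)⁻¹ * H₀⁻¹ with hW₄
  -- sizes
  have hg : ∀ c i, dist1 (loopHol V c i) ≤ τ := fun c i => dist1_loopHol_le hθ0 hV c i
  have hgW₁ : ∀ i, dist1 (W₁ i) ≤ τ := fun i => hg c₁ i
  have hgW₂ : ∀ i, dist1 (W₂ i) ≤ τ := fun i => by rw [hW₂]; simp only; rw [GaugeGroup.dist1_conj]; exact hg c₂ i
  have hgW₃ : ∀ i, dist1 (W₃ i) ≤ τ := fun i => by rw [hW₃]; simp only; rw [GaugeGroup.dist1_conj, GaugeGroup.dist1_inv]; exact hg c₃ i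
  have hgW₄ : ∀ i, dist1 (W₄ i) ≤ τ := fun i => by rw [hW₄]; simp only; rw [GaugeGroup.dist1_conj, GaugeGroup.dist1_inv]; exact hg c₄ i
  have hH₀d : dist1 H₀ ≤ τ := (le_of_lt (plaqSmall_axialAvg hj hV Q)).trans hL2
  -- the guard and the loop form (✓G9)
  have hSm : ∀ c, Small ℰ V c := fun c => small_of_plaqSmall ℰ hθ0 hV hδ c
  have hword : GaugeField.plaqHol (avgFun ℰ V) Q = ℰ.avg W₁ * ℰ.avg W₂ * ℰ.avg W₃ * ℰ.avg W₄ * H₀ :=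
    FluctuationComparisonRegPrIntLS2BetaPlaquetteWordLoopForm.plaqWord_avgFun_eq_loopForm ℰ V c₁ c₂ c₃ c₄ (hSm c₁) (hSm c₂) (hSm c₃) (hSm c₄)
  -- logs of members
  have hτh : τ ≤ 1 / 2 := by linarith
  have size : ∀ (W : Idx P → Matrix.specialUnitaryGroup n ℂ), (∀ i, dist1 (W i) ≤ τ) → ∀ i, ‖mlog (W i : Matrix n n ℂ)‖ ≤ 2 * τ := fun W hWτ i => by
    have h1 : ‖(W i : Matrix n n ℂ) - 1‖ ≤ 1 / 2 := (hWτ i).trans hτh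
    exact (norm_mlog_le_two_mul h1).trans (by have : ‖(W i : Matrix n n ℂ) - 1‖ ≤ τ := hWτ i; linarith)
  have havg : ∀ (W : Idx P → Matrix.specialUnitaryGroup n ℂ), (∀ i, dist1 (W i) ≤ τ) →
      ((ℰ.avg W : Matrix.specialUnitaryGroup n ℂ) : Matrix n n ℂ) = exp (((Fintype.card (Idx P) : ℝ))⁻¹ • ∑ i, mlog (W i : Matrix n n ℂ)) := fun W hW =>
    coe_avg_eq_exp_mean W fun i => (hW i).trans_lt hδ
  have hplaqM : ((GaugeField.plaqHol (avgFun ℰ V) Q : Matrix.specialUnitaryGroup n ℂ) : Matrix n n ℂ) =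
      exp (((Fintype.card (Idx P) : ℝ))⁻¹ • ∑ i, mlog (W₁ i : Matrix n n ℂ)) * exp (((Fintype.card (Idx P) : ℝ))⁻¹ • ∑ i, mlog (W₂ i : Matrix n n ℂ)) *
        exp (((Fintype.card (Idx P) : ℝ))⁻¹ • ∑ i, mlog (W₃ i : Matrix n n ℂ)) * exp (((Fintype.card (Idx P) : ℝ))⁻¹ • ∑ i, mlog (W₄ i : Matrix n n ℂ)) *
        (H₀ : Matrix n n ℂ) := by
    rw [hword]; simp only [Submonoid.coe_mul]; rw [havg W₁ hgW₁, havg W₂ hgW₂, havg W₃ hgW₃, havg W₄ hgW₄]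
  have hHn : ‖(H₀ : Matrix n n ℂ) - 1‖ ≤ Real.exp (2 * τ) - 1 := by
    have h1 : ‖(H₀ : Matrix n n ℂ) - 1‖ ≤ τ := hH₀d
    have h2 := Real.add_one_le_exp (2 * τ)
    linarith
  -- sizes of the averaged plaquette itself (lit Prop. 1, crude form)
  have hplaq : ‖((GaugeField.plaqHol (avgFun ℰ V) Q : Matrix.specialUnitaryGroup n ℂ) : Matrix n n ℂ) - 1‖ ≤ 25 * τ := by
    have h := BlockAveragingPlaquetteBound.dist1_plaqHol_avgFun_lt hj hθ0 hV hδ Q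
    have h' : dist1 (GaugeField.plaqHol (avgFun ℰ V) Q) ≤ ((P.L : ℝ) ^ 2 + 6 * (((P.d + 2) * P.L : ℕ) : ℝ) ^ 2) * θ := le_of_lt h
    have e : ((P.L : ℝ) ^ 2 + 6 * (((P.d + 2) * P.L : ℕ) : ℝ) ^ 2) * θ = (P.L : ℝ) ^ 2 * θ + 24 * τ := by rw [hτdef, hcc]; ring
    rw [e, FederbushMean.dist1_SU_eq] at h'
    linarith only [h', hL2]
  have hm50 : ‖mlog ((GaugeField.plaqHol (avgFun ℰ V) Q : Matrix.specialUnitaryGroup n ℂ) : Matrix n n ℂ)‖ ≤ 50 * τ :=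
    (norm_mlog_le_two_mul (hplaq.trans (by linarith only [hτs]))).trans (by linarith only [hplaq])
  refine ⟨fun i => ⟨hgW₁ i, hgW₂ i, hgW₃ i, hgW₄ i⟩, hHn, hplaqM, hm50, ?_⟩
  rw [FederbushMean.dist1_SU_eq]; exact hplaq

end Summit.QuantumFields.YangMills.Theorems.FluctuationComparisonRegPrIntLS2BetaFieldPackage

end
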